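import Summits.CriticalPhenomena.PercolationContinuityZ3.Theorems.SahiAEFourFunctions
import Literature.Probability.LatticeModels.FourFunctionsAE
import Summits.CriticalPhenomena.PercolationContinuityZ3.Theorems.SahiBoxTP2TFAE
import Summits.CriticalPhenomena.PercolationContinuityZ3.Theorems.SahiBoxTP2Transport
import Literature.Probability.LatticeModels.AffiliationDensity
import Literature.Probability.LatticeModels.MTP2DensityFree
import Literature.Probability.LatticeModels.MTP2PositiveAssociation

/-!
# Densities on the unit cube `Q_d` that are MTP₂ on almost every pair: box-TP₂, and the cell's consequences

Support file of the Sahi cell (`prim-sahi`, typer seat, generation 19; `--supports stmt-CriticalPhenomena-4575`).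
Theorems only (no definitions, no named facts, no sorries).

The cell's theory of box-TP₂ laws on `Q_d = (Fin d → [0,1])` (generations 11–16: `isBoxTP2_tfae_cube`, Sahi positivity
given `LiebSahiContinuum d n`, a.e.-monotone coupling, CIS, tilts, weak limits) was fed, for laws with a Lebesgue
density `ρ`, by `IsBoxTP2.withDensity_volume`, which needs `ρ(x)ρ(y) ≤ ρ(x∧y)ρ(x∨y)` at EVERY pair.  With the
almost-everywhere four functions theorem the intrinsic hypothesis suffices and is also necessary:

* `lintegral_four_functions_unitCube_ae` — Karlin–Rinott Thm. 2.1 for Lebesgue measure on `Q_d` with the lattice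
  hypothesis for `λ ⊗ λ`-ALMOST EVERY PAIR (transport of `lintegral_four_functions_ae` through the inclusion
  `Q_d ↪ ℝ^d` and the clamp `ℝ^d → Q_d`).
* `isBoxTP2_withDensity_volume_of_ae` — `ρ` measurable, MTP₂ on `λ ⊗ λ`-a.e. pair ⟹ `ρ·λ` is box-TP₂.
* `map_incl_withDensity_volume`, `mIsSetTP2_of_isBoxTP2_cube` (finite measures), `ae_pair_mtp2_of_isBoxTP2_withDensity_volume`
  — the converse for `∫ ρ < ∞`: a box-TP₂ law `ρ·λ` has `ρ` MTP₂ on almost every pair (push to `ℝ^d`, where the law is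
  `(⊗ λ|[0,1])·(ρ ∘ clamp)`, and the literature seat's Besicovitch argument); hence
  **`isBoxTP2_withDensity_volume_iff_ae`**: for a finite law on `Q_d` with Lebesgue density, box-TP₂ ⟺ (by the cube
  TFAE) set-TP₂ ⟺ affiliated ⟺ the density is MTP₂ on ALMOST EVERY PAIR.
* `msahiE_nonneg_withDensity_volume_of_ae` — `LiebSahiContinuum d n` ⟹ `E_n(f) ≥ 0` under every a.e.-pair MTP₂
  probability density on `Q_d`, all measurable nonnegative monotone families (no boundedness needed on `Q_d`);
  `liebSahiContinuum_iff_withDensity_ae` — the continuum statement ⟺ that positivity (the class of test laws may be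
  taken to be the a.e.-pair MTP₂ densities; cf. `SahiCubeDensity.liebSahiContinuum_iff_withDensity`, bounded
  everywhere-MTP₂ densities).

No sorries, no new axioms.
-/

noncomputable section

namespace Summit.CriticalPhenomena.PercolationContinuityZ3.Theorems.SahiAEFourFunctions

open MeasureTheory Set Filter Literature.Combinatorics.Sahi2008
open Literature.Probability.LatticeModels Literature.Probability.LatticeModels.Affiliation
open Summit.CriticalPhenomena.PercolationContinuityZ3.Theorems.SahiBoxTP2
open Summit.CriticalPhenomena.PercolationContinuityZ3.Theorems.SahiCubeDensity (clampCube clampCube_sup clampCube_inf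
  measurable_clampCube)
open scoped ENNReal unitInterval

variable {d n : ℕ}

/-! ### Plumbing: the inclusion `Q_d ↪ ℝ^d` and the clamp -/

/-- The clamp is a left inverse of the inclusion. [folklore] -/
private theorem clampCube_incl (x : Fin d → I) : clampCube (fun j => (x j : ℝ)) = x :=
  funext fun j => projIcc_val zero_le_one (x j)

/-- The inclusion `Q_d → ℝ^d` pushes Lebesgue measure to the product of the restricted Lebesgue measures. [folklore] -/
private theorem measurePreserving_incl :
    MeasurePreserving (fun (x : Fin d → I) (j : Fin d) => (x j : ℝ)) (volume : Measure (Fin d → I))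
      (Measure.pi fun _ : Fin d => (volume : Measure ℝ).restrict (Icc (0 : ℝ) 1)) :=
  measurePreserving_pi (fun _ : Fin d => (volume : Measure I)) _ fun _ => unitInterval.measurePreserving_coe

/-- The inclusion `Q_d → ℝ^d` is measurable. [folklore] -/
private theorem measurable_incl : Measurable fun (x : Fin d → I) (j : Fin d) => (x j : ℝ) :=
  measurable_pi_lambda _ fun j => measurable_subtype_coe.comp (measurable_pi_apply j)

/-- Coordinatewise `⊓` is measurable on `ℝ^d × ℝ^d`. [folklore] -/
private theorem measurable_inf_pi_real : Measurable fun p : (Fin d → ℝ) × (Fin d → ℝ) => p.1 ⊓ p.2 :=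
  measurable_pi_iff.2 fun j =>
    ((measurable_pi_apply j).comp measurable_fst).min ((measurable_pi_apply j).comp measurable_snd)

/-- Coordinatewise `⊔` is measurable on `ℝ^d × ℝ^d`. [folklore] -/
private theorem measurable_sup_pi_real : Measurable fun p : (Fin d → ℝ) × (Fin d → ℝ) => p.1 ⊔ p.2 :=
  measurable_pi_iff.2 fun j =>
    ((measurable_pi_apply j).comp measurable_fst).max ((measurable_pi_apply j).comp measurable_snd)

/-! ### The a.e. four functions theorem on `Q_d` -/

/-- **Karlin–Rinott Thm. 2.1 for Lebesgue measure on `Q_d`, hypothesis on almost every pair**: measurable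
`f₁,…,f₄ : Q_d → [0,∞]` with `f₁(x) f₂(y) ≤ f₃(x ∨ y) f₄(x ∧ y)` for `λ ⊗ λ`-a.e. `(x,y)` satisfy
`(∫f₁)(∫f₂) ≤ (∫f₃)(∫f₄)` — Batty–Bollmann's almost-everywhere four functions theorem for the totally ordered
probability spaces `([0,1], λ)`, `d` factors (doc-only v2 re-tag, cell finding A33-1). [cite: BattyBollmann1980, Thm. 3.7] -/
theorem lintegral_four_functions_unitCube_ae (f₁ f₂ f₃ f₄ : (Fin d → I) → ℝ≥0∞) (hm₁ : Measurable f₁)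
    (hm₂ : Measurable f₂) (hm₃ : Measurable f₃) (hm₄ : Measurable f₄)
    (h : ∀ᵐ p ∂(volume : Measure (Fin d → I)).prod (volume : Measure (Fin d → I)),
      f₁ p.1 * f₂ p.2 ≤ f₃ (p.1 ⊔ p.2) * f₄ (p.1 ⊓ p.2)) :
    (∫⁻ x, f₁ x ∂(volume : Measure (Fin d → I))) * (∫⁻ x, f₂ x ∂(volume : Measure (Fin d → I))) ≤
      (∫⁻ x, f₃ x ∂(volume : Measure (Fin d → I))) * (∫⁻ x, f₄ x ∂(volume : Measure (Fin d → I))) := by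
  set ν : Fin d → Measure ℝ := fun _ => (volume : Measure ℝ).restrict (Icc (0 : ℝ) 1) with hν
  have tr : ∀ f : (Fin d → I) → ℝ≥0∞, Measurable f → ∫⁻ x, f x ∂(volume : Measure (Fin d → I)) =
      ∫⁻ y, (f ∘ clampCube) y ∂(Measure.pi ν) := by
    intro f hf
    rw [← measurePreserving_incl.lintegral_comp (hf.comp measurable_clampCube)]
    refine lintegral_congr fun x => ?_
    simp only [Function.comp_apply, clampCube_incl]
  rw [tr f₁ hm₁, tr f₂ hm₂, tr f₃ hm₃, tr f₄ hm₄]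
  refine Literature.Probability.LatticeModels.lintegral_four_functions_ae ν _ _ _ _ (hm₁.comp measurable_clampCube) (hm₂.comp measurable_clampCube)
    (hm₃.comp measurable_clampCube) (hm₄.comp measurable_clampCube) ?_
  -- transport of the a.e. hypothesis along `incl × incl`
  have hmp := measurePreserving_incl (d := d) |>.prod (measurePreserving_incl (d := d))
  rw [← hmp.map_eq]
  have hmeas : MeasurableSet {p : (Fin d → ℝ) × (Fin d → ℝ) |
      (f₁ ∘ clampCube) p.1 * (f₂ ∘ clampCube) p.2 ≤ (f₃ ∘ clampCube) (p.1 ⊔ p.2) * (f₄ ∘ clampCube) (p.1 ⊓ p.2)} :=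
    measurableSet_le
      (((hm₁.comp measurable_clampCube).comp measurable_fst).mul ((hm₂.comp measurable_clampCube).comp measurable_snd))
      (((hm₃.comp measurable_clampCube).comp measurable_sup_pi_real).mul
        ((hm₄.comp measurable_clampCube).comp measurable_inf_pi_real))
  refine (ae_map_iff hmp.measurable.aemeasurable hmeas).2 ?_
  filter_upwards [h] with p hp
  simpa only [Function.comp_apply, Prod.map, clampCube_sup, clampCube_inf, clampCube_incl] using hp

/-- **a.e.-pair MTP₂ densities on `Q_d` give box-TP₂ laws**: `ρ : Q_d → [0,∞]` measurable with
`ρ(x) ρ(y) ≤ ρ(x ∧ y) ρ(x ∨ y)` for `λ ⊗ λ`-almost every `(x,y)` ⟹ `IsBoxTP2 (ρ·λ)`. [this work] -/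
theorem isBoxTP2_withDensity_volume_of_ae (ρ : (Fin d → I) → ℝ≥0∞) (hρm : Measurable ρ)
    (hρ : ∀ᵐ p ∂(volume : Measure (Fin d → I)).prod (volume : Measure (Fin d → I)),
      ρ p.1 * ρ p.2 ≤ ρ (p.1 ⊓ p.2) * ρ (p.1 ⊔ p.2)) :
    IsBoxTP2 ((volume : Measure (Fin d → I)).withDensity ρ) := by
  intro a b a' b'
  rw [withDensity_apply _ measurableSet_Icc, withDensity_apply _ measurableSet_Icc,
    withDensity_apply _ measurableSet_Icc, withDensity_apply _ measurableSet_Icc, ← lintegral_indicator measurableSet_Icc,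
    ← lintegral_indicator measurableSet_Icc, ← lintegral_indicator measurableSet_Icc,
    ← lintegral_indicator measurableSet_Icc, mul_comm (∫⁻ x, (Icc (a ⊓ a') (b ⊓ b')).indicator ρ x)]
  refine lintegral_four_functions_unitCube_ae _ _ _ _ (hρm.indicator measurableSet_Icc)
    (hρm.indicator measurableSet_Icc) (hρm.indicator measurableSet_Icc) (hρm.indicator measurableSet_Icc) ?_
  filter_upwards [hρ] with p hp
  by_cases hx : p.1 ∈ Icc a b
  · by_cases hy : p.2 ∈ Icc a' b'
    · rw [indicator_of_mem hx, indicator_of_mem hy,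
        indicator_of_mem (show p.1 ⊔ p.2 ∈ Icc (a ⊔ a') (b ⊔ b') from ⟨sup_le_sup hx.1 hy.1, sup_le_sup hx.2 hy.2⟩),
        indicator_of_mem (show p.1 ⊓ p.2 ∈ Icc (a ⊓ a') (b ⊓ b') from ⟨inf_le_inf hx.1 hy.1, inf_le_inf hx.2 hy.2⟩),
        mul_comm (ρ (p.1 ⊔ p.2))]
      exact hp
    · rw [indicator_of_notMem hy, mul_zero]
      exact zero_le
  · rw [indicator_of_notMem hx, zero_mul]
    exact zero_le

/-! ### The converse: box-TP₂ laws with a density have a.e.-pair MTP₂ densities -/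

/-- **Box-TP₂ ⟹ set-TP₂ for FINITE measures on `Q_d`** (the cell's probability-measure statement, rescaled).
[this work] -/
theorem mIsSetTP2_of_isBoxTP2_cube (μ : Measure (Fin d → I)) [IsFiniteMeasure μ] (hμ : IsBoxTP2 μ) :
    mIsSetTP2 μ := by
  rcases eq_or_ne μ 0 with h0 | h0
  · intro A B _ _; simp [h0]
  have hc0 : μ univ ≠ 0 := by rwa [Ne, Measure.measure_univ_eq_zero]
  have hcT : μ univ ≠ ∞ := measure_ne_top _ _
  set μ₀ : Measure (Fin d → I) := (μ univ)⁻¹ • μ with hμ₀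
  haveI : IsProbabilityMeasure μ₀ :=
    ⟨by rw [hμ₀, Measure.smul_apply, smul_eq_mul, ENNReal.inv_mul_cancel hc0 hcT]⟩
  have h₀ : mIsSetTP2 μ₀ := IsBoxTP2.mIsSetTP2 μ₀ (hμ.smul _)
  have hback : μ = (μ univ) • μ₀ := by
    rw [hμ₀, smul_smul, ENNReal.mul_inv_cancel hc0 hcT, one_smul]
  rw [hback]
  exact h₀.smul _

/-- **The law `ρ·λ` on `Q_d` pushed to `ℝ^d`** is `(⊗ λ|[0,1])·(ρ ∘ clamp)`. [this work] -/
theorem map_incl_withDensity_volume (ρ : (Fin d → I) → ℝ≥0∞) (hρm : Measurable ρ) :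
    ((volume : Measure (Fin d → I)).withDensity ρ).map (fun (x : Fin d → I) (j : Fin d) => (x j : ℝ)) =
      (Measure.pi fun _ : Fin d => (volume : Measure ℝ).restrict (Icc (0 : ℝ) 1)).withDensity (ρ ∘ clampCube) := by
  ext s hs
  rw [Measure.map_apply measurable_incl hs, withDensity_apply _ (measurable_incl hs), withDensity_apply _ hs,
    ← lintegral_indicator (measurable_incl hs), ← lintegral_indicator hs,
    ← measurePreserving_incl.lintegral_comp ((hρm.comp measurable_clampCube).indicator hs)]
  refine lintegral_congr fun x => ?_
  by_cases hx : (fun j => (x j : ℝ)) ∈ s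
  · rw [indicator_of_mem (show x ∈ (fun (x : Fin d → I) (j : Fin d) => (x j : ℝ)) ⁻¹' s from hx),
      indicator_of_mem hx, Function.comp_apply, clampCube_incl]
  · rw [indicator_of_notMem (show x ∉ (fun (x : Fin d → I) (j : Fin d) => (x j : ℝ)) ⁻¹' s from hx),
      indicator_of_notMem hx]

/-- **Box-TP₂ law with a density on `Q_d` ⟹ the density is MTP₂ on almost every pair** (`∫ ρ < ∞`).  Push to `ℝ^d`
along the lattice embedding `Q_d ↪ ℝ^d` (set-TP₂ is preserved, `mIsSetTP2.map_of_map_sup_inf`), identify the image law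
as `(⊗ λ|[0,1])·(ρ ∘ clamp)`, apply the literature seat's `ae_pair_latticeCondition_of_mIsSetTP2`, pull back.
[this work] -/
theorem ae_pair_mtp2_of_isBoxTP2_withDensity_volume (ρ : (Fin d → I) → ℝ≥0∞) (hρm : Measurable ρ)
    (hfin : ∫⁻ x, ρ x ∂(volume : Measure (Fin d → I)) ≠ ∞)
    (h : IsBoxTP2 ((volume : Measure (Fin d → I)).withDensity ρ)) :
    ∀ᵐ p ∂(volume : Measure (Fin d → I)).prod (volume : Measure (Fin d → I)),
      ρ p.1 * ρ p.2 ≤ ρ (p.1 ⊓ p.2) * ρ (p.1 ⊔ p.2) := by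
  set ν : Fin d → Measure ℝ := fun _ => (volume : Measure ℝ).restrict (Icc (0 : ℝ) 1) with hν
  haveI : ∀ j, IsFiniteMeasure (ν j) := fun _ => by
    rw [hν]; exact ⟨by rw [Measure.restrict_apply_univ]; exact measure_Icc_lt_top⟩
  haveI : IsFiniteMeasure ((volume : Measure (Fin d → I)).withDensity ρ) := isFiniteMeasure_withDensity hfin
  -- set-TP₂ on `Q_d`, then on `ℝ^d`
  have hset : mIsSetTP2 ((volume : Measure (Fin d → I)).withDensity ρ) := mIsSetTP2_of_isBoxTP2_cube _ h
  have hset' : mIsSetTP2 ((Measure.pi ν).withDensity (ρ ∘ clampCube)) := by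
    rw [← map_incl_withDensity_volume ρ hρm]
    exact hset.map_of_map_sup_inf measurable_incl (fun x y => rfl) (fun x y => rfl)
  -- the literature seat's a.e.-pair theorem on `ℝ^d`
  have hfin' : ∫⁻ y, (ρ ∘ clampCube) y ∂Measure.pi ν ≠ ∞ := by
    rw [← measurePreserving_incl.lintegral_comp (hρm.comp measurable_clampCube)]
    simpa only [Function.comp_apply, clampCube_incl] using hfin
  have hae := ae_pair_latticeCondition_of_mIsSetTP2 ν (ρ ∘ clampCube) (hρm.comp measurable_clampCube) hfin' hset'
  -- pull back along `incl × incl`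
  have hmp := measurePreserving_incl (d := d) |>.prod (measurePreserving_incl (d := d))
  filter_upwards [hmp.quasiMeasurePreserving.ae hae] with p hp
  simpa only [Function.comp_apply, Prod.map, clampCube_sup, clampCube_inf, clampCube_incl] using hp

/-- **For a finite law on `Q_d` with a Lebesgue density: box-TP₂ ⟺ the density is MTP₂ on almost every pair.**  With
the cube TFAE (`isBoxTP2_tfae_cube`, probability laws): ⟺ set-TP₂ ⟺ affiliated ⟺ FKG lattice condition of all cell
weights ⟺ …. [this work] -/
theorem isBoxTP2_withDensity_volume_iff_ae (ρ : (Fin d → I) → ℝ≥0∞) (hρm : Measurable ρ)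
    (hfin : ∫⁻ x, ρ x ∂(volume : Measure (Fin d → I)) ≠ ∞) :
    IsBoxTP2 ((volume : Measure (Fin d → I)).withDensity ρ) ↔
      ∀ᵐ p ∂(volume : Measure (Fin d → I)).prod (volume : Measure (Fin d → I)),
        ρ p.1 * ρ p.2 ≤ ρ (p.1 ⊓ p.2) * ρ (p.1 ⊔ p.2) :=
  ⟨ae_pair_mtp2_of_isBoxTP2_withDensity_volume ρ hρm hfin, isBoxTP2_withDensity_volume_of_ae ρ hρm⟩

/-! ### Sahi positivity -/

/-- **`LiebSahiContinuum d n` ⟹ Sahi positivity of order `n` for every a.e.-pair MTP₂ probability density on `Q_d`**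
and all measurable nonnegative coordinatewise non-decreasing families. [this work] -/
theorem msahiE_nonneg_withDensity_volume_of_ae (h : LiebSahiContinuum d n) (ρ : (Fin d → I) → ℝ≥0∞)
    (hρm : Measurable ρ)
    (hρ : ∀ᵐ p ∂(volume : Measure (Fin d → I)).prod (volume : Measure (Fin d → I)),
      ρ p.1 * ρ p.2 ≤ ρ (p.1 ⊓ p.2) * ρ (p.1 ⊔ p.2))
    [IsProbabilityMeasure ((volume : Measure (Fin d → I)).withDensity ρ)] (f : Fin n → (Fin d → I) → ℝ)
    (hfm : ∀ i, Measurable (f i)) (hf0 : ∀ i x, 0 ≤ f i x) (hmono : ∀ i, Monotone (f i)) :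
    0 ≤ msahiE ((volume : Measure (Fin d → I)).withDensity ρ) n f :=
  msahiE_nonneg_of_isBoxTP2 h _ (isBoxTP2_withDensity_volume_of_ae ρ hρm hρ) f hfm hf0 hmono

/-- **Lieb–Sahi's continuous case of order `n` on `Q_d` ⟺ Sahi positivity of order `n` of every a.e.-pair MTP₂
probability density on `Q_d`** (measurable nonnegative monotone families).  The content is `⟹` (`msahiE_nonneg_withDensity_volume_of_ae`);
`⟸` is the instance `ρ ≡ 1` (Lebesgue measure itself), i.e. the definition of `LiebSahiContinuum d n`. [this work] -/
theorem liebSahiContinuum_iff_withDensity_ae :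
    LiebSahiContinuum d n ↔
      ∀ ρ : (Fin d → I) → ℝ≥0∞, Measurable ρ →
        (∀ᵐ p ∂(volume : Measure (Fin d → I)).prod (volume : Measure (Fin d → I)),
          ρ p.1 * ρ p.2 ≤ ρ (p.1 ⊓ p.2) * ρ (p.1 ⊔ p.2)) →
        IsProbabilityMeasure ((volume : Measure (Fin d → I)).withDensity ρ) →
          ∀ f : Fin n → (Fin d → I) → ℝ, (∀ i, Measurable (f i)) → (∀ i x, 0 ≤ f i x) → (∀ i, Monotone (f i)) →
            0 ≤ msahiE ((volume : Measure (Fin d → I)).withDensity ρ) n f := by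
  refine ⟨fun h ρ hρm hρ hP f hfm hf0 hmono => ?_, fun h => ?_⟩
  · haveI := hP
    exact msahiE_nonneg_withDensity_volume_of_ae h ρ hρm hρ f hfm hf0 hmono
  · have h1 := h (1 : (Fin d → I) → ℝ≥0∞) measurable_const (Eventually.of_forall fun _ => le_rfl)
    rw [withDensity_one] at h1
    exact liebSahiContinuum_iff_mSahiPositive.2
      (LebesgueCube.mSahiPositive_volume_of_measurable fun f hfm hf0 hmono => h1 inferInstance f hfm hf0 hmono)

end Summit.CriticalPhenomena.PercolationContinuityZ3.Theorems.SahiAEFourFunctions
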